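import Literature.Probability.Percolation.CerfCentralInequality
import Literature.Probability.Percolation.CerfLem71Proofs
import HarnessLib

/-!
# Cerf 2015, §9: the exponent iteration (Theorem 1.1 from the recursive inequality)

Topic `Literature/Probability/Percolation`. R. Cerf, *A lower bound on the two-arms exponent
for critical percolation on the lattice*, Ann. Probab. 43 (2015) 2458–2480, arXiv:1306.3105,
§9 (p. 14). We prove that the recursive inequality of §8–§9
(`Cerf2015_sec9_recursion`, `CerfCentralInequality.lean`),
`P(two-arms(0,3n)) ≤ (c ln n/√n)(k^{−(d−1)} + k^{2d²+2d−2} P(two-arms(0,n−k−2)))^{1/2}`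
(`n ≥ 2`, `1 ≤ k ≤ n−3`), implies Theorem 1.1 in its `θ(p) > 0` form
(`Cerf2015_thm_1_1_of_siteTheta_pos`, `CerfTwoArms.lean`):
`∀ γ < γ_∞ = (2d²+3d−3)/(4d²+5d−5), ∃ c, ∀ n ≥ 1, P_p(two-arms(0,n)) ≤ c n^{−γ}`, and hence
(with `CerfLem71Proofs.lean`) Cerf's Theorem 1.3 from that single inequality.

## The argument (Cerf 2015, §9, p. 14), as formalised

Write `Q(γ)` for "`∃ c ∀ n ≥ 1, P(two-arms(0,n)) ≤ c n^{−γ}`" and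
`f(γ) = 1/2 + (d−1)γ/(4d²+6d−6)`. *Step*: if `Q(γ)` with `0 ≤ γ < 1` then `Q(γ')` for every
`γ' < f(γ)`: choose `k = ⌈n^δ⌉`, `δ = γ/(2d²+3d−3)`, in the recursion, so that both terms of the
bracket are `O(n^{−δ(d−1)})`, giving `P(two-arms(0,3n)) ≤ C (ln n) n^{−f(γ)}` for large `n`;
the logarithm (Cerf carries powers of `ln n`) is absorbed by `γ' < f(γ)`, all `n` are reached
through the monotonicity `two-arms(0,m) ⊆ two-arms(0,3⌊m/3⌋)` and small `n` go into the
constant. *Iteration*: `Q(0)` holds trivially; with `γ_0 = 0`, `γ_{i+1} = f(γ_i)` one gets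
`Q(γ)` for all `γ < γ_i`, and `γ_i ↑ γ_∞`, the fixed point of `f`
(`cerfTwoArmsExponent_fixedPoint`). (Cerf starts from `γ_0 = 1/2`, Prop. 5.2; starting from
`0` makes Prop. 5.2 unnecessary here — it is the case `k = 1` of the recursion anyway.) The
degenerate parameter `p = 1` (where `θ(p) > 0` but the recursion is not available) is settled
by `two-arms(0,n) ⊆ {0 closed}`.

## Main results

* `exponent_iteration`: the abstract real-variable iteration lemma;
* `siteTwoArms_antitone`: `m ↦ two-arms(0,m)` is decreasing on `m ≥ 1` (Cerf 2015, p. 14,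
  "By monotonicity");
* `Cerf2015_thm_1_1_of_siteTheta_pos_of_recursion :
    Cerf2015_sec9_recursion → Cerf2015_thm_1_1_of_siteTheta_pos`;
* `Cerf2015_thm_1_3_of_recursion`, `Cerf2015_thm_1_3_three_of_recursion`.
-/

noncomputable section

open MeasureTheory Filter Topology Literature.Probability.LatticeModels Literature.Probability.Percolation

namespace Literature.Probability.Percolation

section CritPerc

variable {V : Type*} {d : ℕ}

/-! ### Real-variable lemmas -/

section Analysis

/-- `Q(0)`: a sequence bounded by `1` decays at order `0`. (Below, "`Q(γ)`" stands for
`∃ c, ∀ n ≥ 1, P n ≤ c n^{−γ}`.) [folklore] -/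
theorem polyDecay_zero {P : ℕ → ℝ} (hP1 : ∀ n, P n ≤ 1) :
    ∃ c : ℝ, ∀ n : ℕ, 1 ≤ n → P n ≤ c * (n : ℝ) ^ (-(0 : ℝ)) :=
  ⟨1, fun n _ => by simpa using hP1 n⟩

/-- `Q(γ)` is monotone: `Q(γ) ⇒ Q(γ')` for `γ' ≤ γ`. [folklore] -/
theorem polyDecay_mono {P : ℕ → ℝ} {γ γ' : ℝ}
    (h : ∃ c : ℝ, ∀ n : ℕ, 1 ≤ n → P n ≤ c * (n : ℝ) ^ (-γ)) (hle : γ' ≤ γ) :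
    ∃ c : ℝ, ∀ n : ℕ, 1 ≤ n → P n ≤ c * (n : ℝ) ^ (-γ') := by
  obtain ⟨c, hc⟩ := h
  refine ⟨max c 0, fun n hn => (hc n hn).trans ?_⟩
  have hn1 : (1 : ℝ) ≤ n := by exact_mod_cast hn
  have h1 : (n : ℝ) ^ (-γ) ≤ (n : ℝ) ^ (-γ') :=
    Real.rpow_le_rpow_of_exponent_le hn1 (by linarith)
  calc c * (n : ℝ) ^ (-γ) ≤ max c 0 * (n : ℝ) ^ (-γ) :=
        mul_le_mul_of_nonneg_right (le_max_left _ _) (Real.rpow_nonneg (by linarith) _)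
    _ ≤ max c 0 * (n : ℝ) ^ (-γ') := mul_le_mul_of_nonneg_left h1 (le_max_right _ _)

/-- `x^δ ≤ x/4` for `x ≥ 4^{1/(1−δ)}`, `δ < 1`. [folklore] -/
theorem rpow_le_quarter {δ : ℝ} (hδ1 : δ < 1) {x : ℝ}
    (hx : (4 : ℝ) ^ (1 / (1 - δ)) ≤ x) : x ^ δ ≤ x / 4 := by
  have h4 : (0 : ℝ) < (4 : ℝ) ^ (1 / (1 - δ)) := Real.rpow_pos_of_pos (by norm_num) _
  have hx0 : 0 < x := h4.trans_le hx
  have h1δ : 0 < 1 - δ := by linarith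
  have key : (4 : ℝ) ≤ x ^ (1 - δ) := by
    calc (4 : ℝ) = ((4 : ℝ) ^ (1 / (1 - δ))) ^ (1 - δ) := by
          rw [← Real.rpow_mul (by norm_num), one_div_mul_cancel h1δ.ne', Real.rpow_one]
      _ ≤ x ^ (1 - δ) := Real.rpow_le_rpow h4.le hx h1δ.le
  have hsplit : x = x ^ δ * x ^ (1 - δ) := by
    rw [← Real.rpow_add hx0, add_sub_cancel, Real.rpow_one]
  rw [le_div_iff₀ (by norm_num : (0 : ℝ) < 4)]
  calc x ^ δ * 4 ≤ x ^ δ * x ^ (1 - δ) :=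
        mul_le_mul_of_nonneg_left key (Real.rpow_nonneg hx0.le _)
    _ = x := hsplit.symm

/-- **The step of the iteration** (Cerf 2015, §9, p. 14: "Suppose that for some positive
constants `c', β, γ`, with `γ < 1`, `∀ n ≥ 2, P(two-arms(0,n)) ≤ c'(ln n)^β/n^γ`. Choosing
`k = n^δ` with `δ = γ/(2d²+3d−3)` … `∀ n ≥ 2, P(two-arms(0,n)) ≤ c''(ln n)^{β+1}/n^{γ'}`,
`γ' = 1/2 + (d−1)γ/(4d²+6d−6)`"), in the log-free form `Q(γ) ⇒ Q(γ'')` for all `γ'' < γ'`, for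
an abstract sequence `P` satisfying the recursion with exponents `a = d−1`, `b = 2d²+2d−2`.
[cite: Cerf2015, §9] -/
theorem polyDecay_step {a b : ℕ} (ha : 1 ≤ a) {P : ℕ → ℝ} (hP0 : ∀ n, 0 ≤ P n)
    (hP1 : ∀ n, P n ≤ 1) (hanti : ∀ m n : ℕ, 1 ≤ m → m ≤ n → P n ≤ P m) {c : ℝ}
    (hR : ∀ n k : ℕ, 2 ≤ n → 1 ≤ k → k + 3 ≤ n →
      P (3 * n) ≤ c * Real.log n / Real.sqrt n *
        Real.sqrt (1 / (k : ℝ) ^ a + (k : ℝ) ^ b * P (n - k - 2)))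
    {γ : ℝ} (hγ0 : 0 ≤ γ) (hγ1 : γ < 1) (hQ : ∃ c : ℝ, ∀ n : ℕ, 1 ≤ n → P n ≤ c * (n : ℝ) ^ (-γ))
    {γ' : ℝ} (hγ' : γ' < 1 / 2 + a * γ / (2 * (a + b))) :
    ∃ c : ℝ, ∀ n : ℕ, 1 ≤ n → P n ≤ c * (n : ℝ) ^ (-γ') := by
  -- negative target exponents are trivial
  rcases lt_or_ge γ' 0 with hneg | hγ'0
  · exact polyDecay_mono (polyDecay_zero hP1) hneg.le
  obtain ⟨c₁, hc₁⟩ := hQ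
  have hc₁0 : 0 ≤ c₁ := by
    have h := hc₁ 1 le_rfl
    rw [Nat.cast_one, Real.one_rpow, mul_one] at h
    exact (hP0 1).trans h
  -- the exponents
  set A : ℝ := (a : ℝ) with hA
  set B : ℝ := (b : ℝ) with hB
  have hA1 : (1 : ℝ) ≤ A := by rw [hA]; exact_mod_cast ha
  have hB0 : (0 : ℝ) ≤ B := by rw [hB]; exact Nat.cast_nonneg _
  have hAB : 0 < A + B := by linarith
  set δ : ℝ := γ / (A + B) with hδ
  have hδ0 : 0 ≤ δ := div_nonneg hγ0 hAB.le
  have hδ1 : δ < 1 := by rw [hδ, div_lt_one hAB]; linarith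
  have hδAB : δ * (A + B) = γ := by rw [hδ, div_mul_cancel₀ _ hAB.ne']
  set φ : ℝ := 1 / 2 + A * γ / (2 * (A + B)) with hφ
  have hφδ : φ = 1 / 2 + δ * A / 2 := by
    rw [hφ, hδ]; field_simp
  set ε : ℝ := φ - γ' with hε
  have hε0 : 0 < ε := by rw [hε]; linarith
  -- a nonnegative constant in the recursion
  set c' : ℝ := max c 1 with hc'
  have hc'0 : 0 ≤ c' := le_trans zero_le_one (le_max_right _ _)
  have hR' : ∀ n k : ℕ, 2 ≤ n → 1 ≤ k → k + 3 ≤ n →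
      P (3 * n) ≤ c' * Real.log n / Real.sqrt n *
        Real.sqrt (1 / (k : ℝ) ^ a + (k : ℝ) ^ b * P (n - k - 2)) := by
    intro n k hn hk hkn
    refine (hR n k hn hk hkn).trans ?_
    have hlog : 0 ≤ Real.log n := Real.log_nonneg (by exact_mod_cast (by omega : 1 ≤ n))
    have h0 : 0 ≤ Real.log n / Real.sqrt n *
        Real.sqrt (1 / (k : ℝ) ^ a + (k : ℝ) ^ b * P (n - k - 2)) := by positivity
    calc c * Real.log n / Real.sqrt n * Real.sqrt (1 / (k : ℝ) ^ a + (k : ℝ) ^ b * P (n - k - 2))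
        = c * (Real.log n / Real.sqrt n *
            Real.sqrt (1 / (k : ℝ) ^ a + (k : ℝ) ^ b * P (n - k - 2))) := by ring
      _ ≤ c' * (Real.log n / Real.sqrt n *
            Real.sqrt (1 / (k : ℝ) ^ a + (k : ℝ) ^ b * P (n - k - 2))) :=
          mul_le_mul_of_nonneg_right (le_max_left _ _) h0
      _ = _ := by ring
  -- the constant of the bracket and the final constant for large `n`
  set L : ℝ := 1 + (2 : ℝ) ^ b * (2 : ℝ) ^ γ * c₁ with hL
  have hL1 : 1 ≤ L := by
    have : 0 ≤ (2 : ℝ) ^ b * (2 : ℝ) ^ γ * c₁ := by positivity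
    rw [hL]; linarith
  set K : ℝ := c' * Real.sqrt L / ε with hK
  have hK0 : 0 ≤ K := by positivity
  -- large `n`
  set N₀ : ℕ := max 12 ⌈(4 : ℝ) ^ (1 / (1 - δ))⌉₊ with hN₀
  have hmain : ∀ n : ℕ, N₀ ≤ n → P (3 * n) ≤ K * (n : ℝ) ^ (-γ') := by
    intro n hn
    have hn12 : 12 ≤ n := le_trans (le_max_left _ _) hn
    have hx12 : (12 : ℝ) ≤ n := by exact_mod_cast hn12
    have hx0 : (0 : ℝ) < n := by linarith
    have hx1 : (1 : ℝ) ≤ n := by linarith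
    have hn4 : (4 : ℝ) ^ (1 / (1 - δ)) ≤ n :=
      le_trans (Nat.le_ceil _) (by exact_mod_cast le_trans (le_max_right _ _) hn)
    have hxδ : (n : ℝ) ^ δ ≤ n / 4 := rpow_le_quarter hδ1 hn4
    have hxδ1 : (1 : ℝ) ≤ (n : ℝ) ^ δ := Real.one_le_rpow hx1 hδ0
    have hxδ0 : (0 : ℝ) < (n : ℝ) ^ δ := by linarith
    -- the choice of `k`
    set k : ℕ := ⌈(n : ℝ) ^ δ⌉₊ with hk
    have hk0 : 0 < k := Nat.ceil_pos.2 hxδ0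
    have hk1 : 1 ≤ k := hk0
    have hkx : (n : ℝ) ^ δ ≤ k := Nat.le_ceil _
    have hkle : (k : ℝ) ≤ (n : ℝ) ^ δ + 1 := (Nat.ceil_lt_add_one hxδ0.le).le
    have hk2 : (k : ℝ) ≤ 2 * (n : ℝ) ^ δ := by linarith
    have hkpos : (0 : ℝ) < k := by exact_mod_cast hk0
    have hk3 : k + 3 ≤ n := by
      have : (k : ℝ) + 3 ≤ n := by linarith
      exact_mod_cast this
    have hcast : ((n - k - 2 : ℕ) : ℝ) = (n : ℝ) - k - 2 := by
      rw [Nat.cast_sub (by omega), Nat.cast_sub (by omega), Nat.cast_ofNat]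
    have hm2 : (n : ℝ) / 2 ≤ ((n - k - 2 : ℕ) : ℝ) := by rw [hcast]; linarith
    have hm1 : 1 ≤ n - k - 2 := by
      have : (1 : ℝ) ≤ ((n - k - 2 : ℕ) : ℝ) := by linarith
      exact_mod_cast this
    -- the recursion at `(n, k)`
    have hrec := hR' n k (by omega) hk1 hk3
    -- the second term of the bracket
    have hP2 : P (n - k - 2) ≤ c₁ * ((2 : ℝ) ^ γ * (n : ℝ) ^ (-γ)) := by
      refine (hc₁ _ hm1).trans (mul_le_mul_of_nonneg_left ?_ hc₁0)
      have h1 : ((n - k - 2 : ℕ) : ℝ) ^ (-γ) ≤ ((n : ℝ) / 2) ^ (-γ) :=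
        Real.rpow_le_rpow_of_nonpos (by positivity) hm2 (by linarith)
      have h2 : ((n : ℝ) / 2) ^ (-γ) = (2 : ℝ) ^ γ * (n : ℝ) ^ (-γ) := by
        rw [Real.div_rpow hx0.le zero_le_two, Real.rpow_neg zero_le_two, div_inv_eq_mul,
          mul_comm]
      rw [← h2]; exact h1
    have hkb : (k : ℝ) ^ b ≤ (2 : ℝ) ^ b * (n : ℝ) ^ (δ * B) := by
      calc (k : ℝ) ^ b ≤ (2 * (n : ℝ) ^ δ) ^ b := pow_le_pow_left₀ hkpos.le hk2 b
        _ = (2 : ℝ) ^ b * ((n : ℝ) ^ δ) ^ b := mul_pow _ _ _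
        _ = (2 : ℝ) ^ b * (n : ℝ) ^ (δ * B) := by
            rw [hB, Real.rpow_mul hx0.le, Real.rpow_natCast]
    have hka : 1 / (k : ℝ) ^ a ≤ (n : ℝ) ^ (-(δ * A)) := by
      have h1 : 1 / (k : ℝ) ^ a ≤ 1 / ((n : ℝ) ^ δ) ^ a :=
        one_div_le_one_div_of_le (pow_pos hxδ0 a) (pow_le_pow_left₀ hxδ0.le hkx a)
      have h2 : 1 / ((n : ℝ) ^ δ) ^ a = (n : ℝ) ^ (-(δ * A)) := by
        rw [hA, Real.rpow_neg hx0.le, Real.rpow_mul hx0.le, Real.rpow_natCast, one_div]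
      rw [← h2]; exact h1
    have hexp : (n : ℝ) ^ (δ * B) * (n : ℝ) ^ (-γ) = (n : ℝ) ^ (-(δ * A)) := by
      rw [← Real.rpow_add hx0]
      congr 1
      linear_combination hδAB
    have hbr : 1 / (k : ℝ) ^ a + (k : ℝ) ^ b * P (n - k - 2) ≤ L * (n : ℝ) ^ (-(δ * A)) := by
      have h2nd : (k : ℝ) ^ b * P (n - k - 2) ≤
          (2 : ℝ) ^ b * (2 : ℝ) ^ γ * c₁ * (n : ℝ) ^ (-(δ * A)) := by
        calc (k : ℝ) ^ b * P (n - k - 2)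
            ≤ ((2 : ℝ) ^ b * (n : ℝ) ^ (δ * B)) * (c₁ * ((2 : ℝ) ^ γ * (n : ℝ) ^ (-γ))) :=
              mul_le_mul hkb hP2 (hP0 _) (by positivity)
          _ = (2 : ℝ) ^ b * (2 : ℝ) ^ γ * c₁ * ((n : ℝ) ^ (δ * B) * (n : ℝ) ^ (-γ)) := by ring
          _ = (2 : ℝ) ^ b * (2 : ℝ) ^ γ * c₁ * (n : ℝ) ^ (-(δ * A)) := by rw [hexp]
      calc 1 / (k : ℝ) ^ a + (k : ℝ) ^ b * P (n - k - 2)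
          ≤ (n : ℝ) ^ (-(δ * A)) + (2 : ℝ) ^ b * (2 : ℝ) ^ γ * c₁ * (n : ℝ) ^ (-(δ * A)) :=
            add_le_add hka h2nd
        _ = L * (n : ℝ) ^ (-(δ * A)) := by rw [hL]; ring
    have hsqrt : Real.sqrt (1 / (k : ℝ) ^ a + (k : ℝ) ^ b * P (n - k - 2)) ≤
        Real.sqrt L * (n : ℝ) ^ (-(δ * A) / 2) := by
      calc Real.sqrt (1 / (k : ℝ) ^ a + (k : ℝ) ^ b * P (n - k - 2))
          ≤ Real.sqrt (L * (n : ℝ) ^ (-(δ * A))) := Real.sqrt_le_sqrt hbr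
        _ = Real.sqrt L * Real.sqrt ((n : ℝ) ^ (-(δ * A))) :=
            Real.sqrt_mul (by linarith) _
        _ = Real.sqrt L * (n : ℝ) ^ (-(δ * A) / 2) := by
            rw [Real.sqrt_eq_rpow ((n : ℝ) ^ (-(δ * A))), ← Real.rpow_mul hx0.le]
            congr 2
            ring
    have hlogsqrt : Real.log n / Real.sqrt n = Real.log n * (n : ℝ) ^ (-(1 / 2 : ℝ)) := by
      rw [Real.sqrt_eq_rpow, Real.rpow_neg hx0.le, div_eq_mul_inv]
    have hlog0 : 0 ≤ Real.log n := Real.log_nonneg hx1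
    have hlogε : Real.log n * (n : ℝ) ^ (-φ) ≤ 1 / ε * (n : ℝ) ^ (-γ') := by
      have h1 : Real.log n ≤ (n : ℝ) ^ ε / ε := Real.log_le_rpow_div hx0.le hε0
      calc Real.log n * (n : ℝ) ^ (-φ) ≤ (n : ℝ) ^ ε / ε * (n : ℝ) ^ (-φ) :=
            mul_le_mul_of_nonneg_right h1 (Real.rpow_nonneg hx0.le _)
        _ = 1 / ε * ((n : ℝ) ^ ε * (n : ℝ) ^ (-φ)) := by ring
        _ = 1 / ε * (n : ℝ) ^ (-γ') := by
            rw [← Real.rpow_add hx0]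
            congr 2
            rw [hε]; ring
    -- assemble
    calc P (3 * n)
        ≤ c' * Real.log n / Real.sqrt n *
            Real.sqrt (1 / (k : ℝ) ^ a + (k : ℝ) ^ b * P (n - k - 2)) := hrec
      _ ≤ c' * Real.log n / Real.sqrt n * (Real.sqrt L * (n : ℝ) ^ (-(δ * A) / 2)) :=
          mul_le_mul_of_nonneg_left hsqrt (by positivity)
      _ = c' * Real.sqrt L * (Real.log n * ((n : ℝ) ^ (-(1 / 2 : ℝ)) *
            (n : ℝ) ^ (-(δ * A) / 2))) := by
          rw [mul_div_assoc, hlogsqrt]; ring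
      _ = c' * Real.sqrt L * (Real.log n * (n : ℝ) ^ (-φ)) := by
          rw [← Real.rpow_add hx0]
          congr 3
          rw [hφδ]; ring
      _ ≤ c' * Real.sqrt L * (1 / ε * (n : ℝ) ^ (-γ')) :=
          mul_le_mul_of_nonneg_left hlogε (by positivity)
      _ = K * (n : ℝ) ^ (-γ') := by rw [hK]; ring
  -- all `m ≥ 1`
  set M : ℕ := 3 * N₀ + 3 with hM
  have hM0 : (0 : ℝ) < M := by rw [hM]; positivity
  refine ⟨max (K * (6 : ℝ) ^ γ') ((M : ℝ) ^ γ'), fun m hm => ?_⟩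
  have hm0 : (0 : ℝ) < m := by exact_mod_cast hm
  rcases lt_or_ge m M with hsmall | hlarge
  · -- small `m`
    have h1 : (1 : ℝ) ≤ (M : ℝ) ^ γ' * (m : ℝ) ^ (-γ') := by
      have hmM : (m : ℝ) ≤ M := by exact_mod_cast hsmall.le
      have h2 : (M : ℝ) ^ (-γ') ≤ (m : ℝ) ^ (-γ') :=
        Real.rpow_le_rpow_of_nonpos hm0 hmM (by linarith)
      calc (1 : ℝ) = (M : ℝ) ^ γ' * (M : ℝ) ^ (-γ') := by
            rw [Real.rpow_neg hM0.le, mul_inv_cancel₀ (Real.rpow_pos_of_pos hM0 _).ne']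
        _ ≤ (M : ℝ) ^ γ' * (m : ℝ) ^ (-γ') :=
            mul_le_mul_of_nonneg_left h2 (Real.rpow_nonneg hM0.le _)
    calc P m ≤ 1 := hP1 m
      _ ≤ (M : ℝ) ^ γ' * (m : ℝ) ^ (-γ') := h1
      _ ≤ max (K * (6 : ℝ) ^ γ') ((M : ℝ) ^ γ') * (m : ℝ) ^ (-γ') :=
          mul_le_mul_of_nonneg_right (le_max_right _ _) (Real.rpow_nonneg hm0.le _)
  · -- large `m`: compare with `3 ⌊m/3⌋`
    set n : ℕ := m / 3 with hn
    have hnN : N₀ ≤ n := by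
      rw [hn, Nat.le_div_iff_mul_le (by norm_num)]
      omega
    have h3n : 3 * n ≤ m := by rw [hn]; omega
    have hlt : m < n * 3 + 3 := Nat.lt_div_mul_add (by norm_num)
    have hm6 : (m : ℝ) / 6 ≤ n := by
      have h1 : (m : ℝ) < n * 3 + 3 := by exact_mod_cast hlt
      have h2 : (39 : ℝ) ≤ m := by
        have : 39 ≤ m := by omega
        exact_mod_cast this
      linarith
    have hn1 : 1 ≤ 3 * n := by omega
    calc P m ≤ P (3 * n) := hanti (3 * n) m hn1 h3n
      _ ≤ K * (n : ℝ) ^ (-γ') := hmain n hnN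
      _ ≤ K * (((m : ℝ) / 6) ^ (-γ')) :=
          mul_le_mul_of_nonneg_left
            (Real.rpow_le_rpow_of_nonpos (by positivity) hm6 (by linarith)) hK0
      _ = K * (6 : ℝ) ^ γ' * (m : ℝ) ^ (-γ') := by
          rw [Real.div_rpow hm0.le (by norm_num), Real.rpow_neg (by norm_num : (0:ℝ) ≤ 6),
            div_inv_eq_mul]
          ring
      _ ≤ max (K * (6 : ℝ) ^ γ') ((M : ℝ) ^ γ') * (m : ℝ) ^ (-γ') :=
          mul_le_mul_of_nonneg_right (le_max_left _ _) (Real.rpow_nonneg hm0.le _)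

/-- **The exponent iteration** (Cerf 2015, §9, p. 14: "We define a sequence of exponents
`(γ_i)_{i≥0}` by setting `γ_0 = 1/2` and `γ_{i+1} = 1/2 + (d−1)γ_i/(4d²+6d−6)`. Iterating the
previous argument … `limsup (1/ln n) ln P(two-arms(0,n)) ≤ −γ_i`. The sequence `(γ_i)`
converges geometrically towards `γ_∞ = (2d²+3d−3)/(4d²+5d−5)`"), for an abstract sequence
`0 ≤ P ≤ 1`, decreasing on `n ≥ 1`, satisfying the recursion with exponents `a ≥ 1`, `b ≥ 1`
(Cerf: `a = d−1`, `b = 2d²+2d−2`); the limit exponent is `(a+b)/(a+2b)`, the fixed point of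
`γ ↦ 1/2 + aγ/(2(a+b))`, and the iteration is started at `γ_0 = 0`. [cite: Cerf2015, §9] -/
theorem exponent_iteration {a b : ℕ} (ha : 1 ≤ a) (hb : 1 ≤ b) {P : ℕ → ℝ} (hP0 : ∀ n, 0 ≤ P n)
    (hP1 : ∀ n, P n ≤ 1) (hanti : ∀ m n : ℕ, 1 ≤ m → m ≤ n → P n ≤ P m) {c : ℝ}
    (hR : ∀ n k : ℕ, 2 ≤ n → 1 ≤ k → k + 3 ≤ n →
      P (3 * n) ≤ c * Real.log n / Real.sqrt n *
        Real.sqrt (1 / (k : ℝ) ^ a + (k : ℝ) ^ b * P (n - k - 2)))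
    {γ : ℝ} (hγ : γ < ((a : ℝ) + b) / (a + 2 * b)) :
    ∃ C : ℝ, ∀ n : ℕ, 1 ≤ n → P n ≤ C * (n : ℝ) ^ (-γ) := by
  set A : ℝ := (a : ℝ) with hA
  set B : ℝ := (b : ℝ) with hB
  have hA1 : (1 : ℝ) ≤ A := by rw [hA]; exact_mod_cast ha
  have hB1 : (1 : ℝ) ≤ B := by rw [hB]; exact_mod_cast hb
  set s : ℝ := A / (2 * (A + B)) with hs
  have hAB : 0 < A + B := by linarith
  have hs0 : 0 ≤ s := by rw [hs]; positivity
  have hs1 : s < 1 := by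
    rw [hs, div_lt_one (by linarith)]; linarith
  set γinf : ℝ := (A + B) / (A + 2 * B) with hγinf
  have hden : 0 < A + 2 * B := by linarith
  have hfix : γinf = 1 / 2 + s * γinf := by
    rw [hγinf, hs]; field_simp; ring
  have hγinf0 : 0 < γinf := by rw [hγinf]; positivity
  have hγinf1 : γinf < 1 := by rw [hγinf, div_lt_one hden]; linarith
  have hsa : ∀ x : ℝ, (a : ℝ) * x / (2 * ((a : ℝ) + b)) = s * x := by
    intro x; rw [hs, hA, hB]; ring
  -- `Q(γ')` for all `γ' < g i = γinf (1 - s^i)`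
  have key : ∀ i : ℕ, ∀ γ' : ℝ, γ' < γinf * (1 - s ^ i) →
      ∃ c : ℝ, ∀ n : ℕ, 1 ≤ n → P n ≤ c * (n : ℝ) ^ (-γ') := by
    intro i
    induction i with
    | zero =>
      intro γ' h
      rw [pow_zero, sub_self, mul_zero] at h
      exact polyDecay_mono (polyDecay_zero hP1) h.le
    | succ i ih =>
      intro γ'' h''
      set gi : ℝ := γinf * (1 - s ^ i) with hgi
      have hg : γinf * (1 - s ^ (i + 1)) = 1 / 2 + s * gi := by
        rw [hgi, pow_succ]; linear_combination hfix
      rw [hg] at h''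
      have hgi1 : gi < 1 := by
        have : 0 ≤ γinf * s ^ i := by positivity
        have : gi = γinf - γinf * s ^ i := by rw [hgi]; ring
        linarith
      set η : ℝ := 1 / 2 + s * gi - γ'' with hη
      have hη0 : 0 < η := by rw [hη]; linarith
      set γ₀ : ℝ := max (gi - η) 0 with hγ₀
      have hQ₀ : ∃ c : ℝ, ∀ n : ℕ, 1 ≤ n → P n ≤ c * (n : ℝ) ^ (-γ₀) := by
        rcases le_or_gt (gi - η) 0 with h | h
        · rw [hγ₀, max_eq_right h]; simpa using polyDecay_zero hP1
        · rw [hγ₀, max_eq_left h.le]; exact ih _ (by linarith)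
      have hγ₀0 : 0 ≤ γ₀ := le_max_right _ _
      have hγ₀1 : γ₀ < 1 := max_lt (by linarith) one_pos
      refine polyDecay_step ha hP0 hP1 hanti hR hγ₀0 hγ₀1 hQ₀ ?_
      rw [hsa]
      have h1 : gi - η ≤ γ₀ := le_max_left _ _
      have h2 : s * (gi - η) ≤ s * γ₀ := mul_le_mul_of_nonneg_left h1 hs0
      have h3 : s * η < η := by nlinarith
      nlinarith
  -- choose `i` with `γ < g i`
  have hlt : 0 < 1 - γ / γinf := by
    rw [sub_pos, div_lt_one hγinf0]; exact hγ
  obtain ⟨i, hi⟩ := exists_pow_lt_of_lt_one hlt hs1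
  refine key i γ ?_
  have : γ / γinf < 1 - s ^ i := by linarith
  rwa [div_lt_iff₀ hγinf0, mul_comm] at this

end Analysis

/-! ### The two-arms events: monotonicity in the radius, the degenerate parameter -/

section TwoArms

/-- **Monotonicity in the radius** (Cerf 2015, §9, p. 14: "By monotonicity, `∀ n ≥ 3`,
`P(two-arms(0,n)) ≤ P(two-arms(0,⌊n/3⌋))`"): for `1 ≤ m ≤ n`,
`two-arms(0, n) ⊆ two-arms(0, m)` (restrict the two clusters to the smaller box; they stay
disjoint and, by the exit lemma, still reach its inner boundary). [cite: Cerf2015, §9] -/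
theorem siteTwoArms_antitone {m n : ℕ} (hm : 1 ≤ m) (hmn : m ≤ n) :
    siteTwoArms d 0 n ⊆ siteTwoArms d 0 m := by
  classical
  intro ω hω
  obtain ⟨y, z, hy, hz, hdisj, ⟨wy, hwy, hwy'⟩, ⟨wz, hwz, hwz'⟩⟩ := hω
  have hsub : shiftedBox (0 : Site d) m ⊆ shiftedBox 0 n := by
    rw [shiftedBox_zero, shiftedBox_zero]; exact box_mono d hmn
  have hsub' : (↑(shiftedBox (0 : Site d) m) : Set (Site d)) ⊆ ↑(shiftedBox (0 : Site d) n) :=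
    Finset.coe_subset.2 hsub
  refine ⟨y, z, hy, hz, ?_, ?_, ?_⟩
  · exact Set.disjoint_of_subset (fun v hv => siteConnIn_mono _ hsub' _ _ hv)
      (fun v hv => siteConnIn_mono _ hsub' _ _ hv) hdisj
  · exact exists_innerBoundary_siteConnIn_of_subset hsub (mem_shiftedBox_of_adj hm hy) hwy hwy'
  · exact exists_innerBoundary_siteConnIn_of_subset hsub (mem_shiftedBox_of_adj hm hz) hwz hwz'

/-- `two-arms(0, n)` forces the origin to be closed (two disjoint nonempty clusters of
neighbours of an open origin would both contain it). [cite: Cerf2015, §5] -/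
theorem siteTwoArms_subset_origin_closed (n : ℕ) :
    siteTwoArms d 0 n ⊆ {ω | (0 : Site d) ∉ ω} := by
  intro ω hω h0
  obtain ⟨y, z, hy, hz, hdisj, ⟨wy, -, hwy'⟩, ⟨wz, -, hwz'⟩⟩ := hω
  have hyC := root_mem_siteClusterIn hwy'
  have hzC := root_mem_siteClusterIn hwz'
  obtain ⟨hyω, hyS⟩ := mem_open_of_mem_siteClusterIn hyC
  obtain ⟨hzω, hzS⟩ := mem_open_of_mem_siteClusterIn hzC
  have h0S : (0 : Site d) ∈ (↑(shiftedBox (0 : Site d) n) : Set (Site d)) := by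
    rw [shiftedBox_zero, Finset.mem_coe]; exact zero_mem_box d n
  have h0 : (0 : Site d) ∈ ω := h0
  have h1 : ω ∈ siteConnIn (zdGraph d) ↑(shiftedBox (0 : Site d) n) y 0 :=
    mem_siteConnIn_of_adj _ hyω h0 hyS h0S hy.symm
  have h2 : ω ∈ siteConnIn (zdGraph d) ↑(shiftedBox (0 : Site d) n) 0 z :=
    mem_siteConnIn_of_adj _ h0 hzω h0S hzS hz
  have hzy : z ∈ siteClusterIn (zdGraph d) ↑(shiftedBox (0 : Site d) n) ω y :=
    siteConnIn_trans _ subset_rfl subset_rfl h1 h2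
  exact Set.disjoint_left.1 hdisj hzy hzC

/-- `P_p(two-arms(0, n)) ≤ 1 − p`. [cite: Cerf2015, §5] -/
theorem real_siteTwoArms_le_one_sub (p : unitInterval) (n : ℕ) :
    (sitePercolation (Site d) p).real (siteTwoArms d 0 n) ≤ 1 - p := by
  have h := measureReal_compl (μ := sitePercolation (Site d) p)
    (measurableSet_siteOpen (0 : Site d))
  rw [probReal_univ, sitePercolation_real_mem] at h
  have hset : ({ω : SiteConfig (Site d) | (0 : Site d) ∈ ω}ᶜ) =
      {ω : SiteConfig (Site d) | (0 : Site d) ∉ ω} := Set.compl_setOf _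
  rw [hset] at h
  rw [← h]
  exact measureReal_mono (siteTwoArms_subset_origin_closed n) (measure_ne_top _ _)

end TwoArms

/-! ### Theorem 1.1 (`θ(p) > 0` form) from the recursion, and Theorem 1.3 -/

/-- **Cerf 2015, Theorem 1.1 in its `θ(p) > 0` form, from the recursive inequality of §8–§9**
(§9, p. 14): `Cerf2015_sec9_recursion → Cerf2015_thm_1_1_of_siteTheta_pos`. At `p = 1` the
two-arms event is null; for `p < 1` apply `exponent_iteration` with `a = d−1`,
`b = 2d²+2d−2`, whose limit exponent `(a+b)/(a+2b)` is `γ_∞ = cerfTwoArmsExponent d`.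
[cite: Cerf2015, Thm 1.1 and §9] -/
theorem Cerf2015_thm_1_1_of_siteTheta_pos_of_recursion (hR : Cerf2015_sec9_recursion) :
    Cerf2015_thm_1_1_of_siteTheta_pos := by
  intro d hd p hθ γ hγ
  set μ := sitePercolation (Site d) p with hμ
  rcases eq_or_lt_of_le p.2.2 with hp1 | hp1
  · -- `p = 1`: the event is null
    refine ⟨0, fun n _ => ?_⟩
    have h := real_siteTwoArms_le_one_sub (d := d) p n
    rw [hp1, sub_self] at h
    rw [zero_mul]; exact h
  · obtain ⟨c, hc⟩ := hR d hd p hθ hp1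
    have hd1 : 1 ≤ d := le_trans one_le_two hd
    have h2 : 2 ≤ 2 * d ^ 2 + 2 * d := by nlinarith
    have hP0 : ∀ n, 0 ≤ μ.real (siteTwoArms d 0 n) := fun n => measureReal_nonneg
    have hP1 : ∀ n, μ.real (siteTwoArms d 0 n) ≤ 1 := fun n => measureReal_le_one
    have hanti : ∀ m n : ℕ, 1 ≤ m → m ≤ n →
        μ.real (siteTwoArms d 0 n) ≤ μ.real (siteTwoArms d 0 m) := fun m n hm hmn =>
      measureReal_mono (siteTwoArms_antitone hm hmn) (measure_ne_top _ _)
    have hexp : (((d - 1 : ℕ) : ℝ) + ((2 * d ^ 2 + 2 * d - 2 : ℕ) : ℝ)) /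
        (((d - 1 : ℕ) : ℝ) + 2 * ((2 * d ^ 2 + 2 * d - 2 : ℕ) : ℝ)) = cerfTwoArmsExponent d := by
      rw [Nat.cast_sub hd1, Nat.cast_sub h2]
      unfold cerfTwoArmsExponent
      push_cast
      ring_nf
    have hγ' : γ < (((d - 1 : ℕ) : ℝ) + ((2 * d ^ 2 + 2 * d - 2 : ℕ) : ℝ)) /
        (((d - 1 : ℕ) : ℝ) + 2 * ((2 * d ^ 2 + 2 * d - 2 : ℕ) : ℝ)) := by rwa [hexp]
    exact exponent_iteration (P := fun n => μ.real (siteTwoArms d 0 n)) (by omega) (by omega)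
      hP0 hP1 hanti hc hγ'

/-- **Cerf 2015, Theorem 1.3 from the recursive inequality of §8–§9 alone** (with
`CerfLem71Proofs.Cerf2015_thm_1_3_of_thm_1_1`). [cite: Cerf2015, Thm 1.3, §§9–10] -/
theorem Cerf2015_thm_1_3_of_recursion (hR : Cerf2015_sec9_recursion) : Cerf2015_thm_1_3 :=
  Cerf2015_thm_1_3_of_thm_1_1 (Cerf2015_thm_1_1_of_siteTheta_pos_of_recursion hR)

/-- **Cerf 2015, Theorem 1.3 for `d = 3` (`Λ(n^16)`) from the recursive inequality alone.**
[cite: Cerf2015, Thm 1.3 (case d = 3, p. 4), §§9–10] -/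
theorem Cerf2015_thm_1_3_three_of_recursion (hR : Cerf2015_sec9_recursion) :
    Cerf2015_thm_1_3_three :=
  Cerf2015_thm_1_3_three_of_thm_1_1 (Cerf2015_thm_1_1_of_siteTheta_pos_of_recursion hR)

end CritPerc

end Literature.Probability.Percolation
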